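import Literature.NumberTheory.EllipticCurves.X049CMSigmaSqTwoProofs
import Literature.NumberTheory.EllipticCurves.DescendedFrobeniusFormalGroupToolkit
import HarnessLib

/-!
# Route `ByReductionTypeAtTwo`, crux `RankOneAtTwoBigImageOddLocal` (item stmt-BirchSwinnertonDyer-23715), line AN62, σ₀-LEMMA BLOCK
# (cell `bsd-f1-sign2`, planner seat `-an` g49; `--supports 23715`, helper): **rigidity of the sigma-squared equation and the unique
# even constant-`0` solution `Σ₀`** (every prime `p`)

HONEST FRAMING (D-0036/D-0054): THEOREMS ONLY (no definition, no named fact, no `sorry`, no instance); formal power-series algebra,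
NOT a statement about `BSDp`; item 23715 stays OPEN; BSD is proved for no curve.  COROLLARY-OF-PRINT in substance (REF2 v75 add5:
Mazur–Stein–Tate 2006 §3.1–§3.3 / Alg. 3.1 composed with the tree's Blakestad–Grant existence theorem) — landed so that the naive
σ-height theorems `…NaiveSigmaLog*` / `…SigmaHeightFirstOrder` have a gate-backed object to quantify over.  Gate-backed form of the
workfile theorems `eq_of_satisfiesSigmaSqODE` / 50E of `Cruxes/RankOneAtTwoBigImageOddLocal/WildPairHeightAN62.lean` §6 (-an g49).

* §1 **`eq_of_satisfiesSigmaSqODE`** — over any `ℚ`-algebra, two normalised solutions (`Σ = t² + O(t³)`) of `SatisfiesSigmaSqODE · c`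
  with the same `c` and the same `[t³]Σ` coincide (`G = sigmaSqG Σ` is determined by `(m−1)g_m = −2[t^m](ω(t²x + ct²))`, then `Σ/t²` by
  `n·s_n = Σ_{i ≥ 1} [tⁱ](ωG) s_{n−i}`).
* §2 **`existsUnique_isFormallyEven_satisfiesSigmaSqODE_zero`** (50E, every prime `p`, every model over `ℚ_p`) — there is exactly one
  `Σ₀ ∈ ℚ_p⟦t⟧` with `Σ₀ = t² + O(t⁴)` (`[t⁰] = [t¹] = 0`, `[t²] = 1`), formally even, `SatisfiesSigmaSqODE Σ₀ 0`: existence = the square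
  of the tree's odd constant-`0` sigma function (`exists_isFormallyOdd_satisfiesSigmaODE_zero`), uniqueness = evenness pins `[t³]Σ₀ = a₁`
  (`two_mul_coeff_three_of_isFormallyEven`) + §1.

References: [cite: MazurSteinTate2006, Thm. 1.3, §3.1, Alg. 3.1] [cite: BlakestadGrant2023, Thm. 1] [cite: MazurTate1991, §1].
-/

set_option autoImplicit false

noncomputable section

open scoped Classical

open PowerSeries WeierstrassCurve Literature.NumberTheory.EllipticCurves

namespace Summit.BirchSwinnertonDyer.BirchSwinnertonDyer.Theorems

namespace NaiveSigmaLogAtTwo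

/-! ### §1 Rigidity -/

/-- **Rigidity of the sigma-squared equation.**  Over any `ℚ`-algebra, two normalised (`Σ = t² + O(t³)`)
solutions of `SatisfiesSigmaSqODE · c` with the same constant `c` and the same `[t³]Σ` coincide:
`G := sigmaSqG Σ` is determined (`g₀ = 2`, `g₁ = [t³]Σ − 2a₁`, `(m−1)g_m = −2[t^m](ω·(t²x + ct²))`), and then
`S := Σ/t²` by the linear recursion `n·s_n = Σ_{i=1}^{n} [tⁱ](ωG)·s_{n−i}` (`(ωG)·S = 2S + tS′`, `[t⁰](ωG) = 2`).
[cite: MazurSteinTate2006, Thm. 1.3, §3.1 (the one-parameter family of formal solutions)] -/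
theorem eq_of_satisfiesSigmaSqODE {A : Type*} [CommRing A] [Algebra ℚ A] (W : WeierstrassCurve A)
    {Sq₁ Sq₂ : A⟦X⟧} {c : A}
    (h0₁ : constantCoeff Sq₁ = 0) (h1₁ : coeff 1 Sq₁ = 0) (h2₁ : coeff 2 Sq₁ = 1)
    (h0₂ : constantCoeff Sq₂ = 0) (h1₂ : coeff 1 Sq₂ = 0) (h2₂ : coeff 2 Sq₂ = 1)
    (h3 : coeff 3 Sq₁ = coeff 3 Sq₂)
    (hODE₁ : W.SatisfiesSigmaSqODE Sq₁ c) (hODE₂ : W.SatisfiesSigmaSqODE Sq₂ c) : Sq₁ = Sq₂ := by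
  have h2C : (2 : A⟦X⟧) = C (2 : A) := (map_ofNat C 2).symm
  have hω0 : coeff 0 W.formalOmega = 1 := by rw [coeff_zero_eq_constantCoeff]; exact W.constantCoeff_formalOmega
  have hω1 := Literature.NumberTheory.EllipticCurves.DescendedFrobenius.FormalGroupCoefficients.coeff_one_formalOmega W
  -- facts about ONE normalised solution
  have key : ∀ Sq : A⟦X⟧, constantCoeff Sq = 0 → coeff 1 Sq = 0 → coeff 2 Sq = 1 →
      W.SatisfiesSigmaSqODE Sq c →
      (W.formalOmega * W.sigmaSqG Sq) * sigmaShift (sigmaShift Sq) =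
          2 * sigmaShift (sigmaShift Sq) + X * d⁄dX A (sigmaShift (sigmaShift Sq)) ∧
      coeff 0 (W.sigmaSqG Sq) = 2 ∧
      coeff 1 (W.sigmaSqG Sq) = coeff 3 Sq - 2 * W.a₁ ∧
      ∀ n : ℕ, (n : A) * coeff (n + 1) (W.sigmaSqG Sq) =
        -2 * coeff (n + 1) (W.formalOmega * (W.formalXMulSq + C c * X ^ 2)) := by
    intro Sq h0 h1 h2 hODE
    set S : A⟦X⟧ := sigmaShift (sigmaShift Sq) with hS
    have hS0 : constantCoeff S = 1 := by rw [hS, constantCoeff_sigmaShift, coeff_sigmaShift, h2]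
    have hS1 : coeff 1 S = coeff 3 Sq := by rw [hS, coeff_sigmaShift, coeff_sigmaShift]
    set G : A⟦X⟧ := W.sigmaSqG Sq with hG
    have hU0 : constantCoeff (W.formalOmega * S) = 1 := by
      rw [map_mul, W.constantCoeff_formalOmega, hS0, one_mul]
    have hGmul : G * (W.formalOmega * S) = 2 * S + X * d⁄dX A S := by
      rw [hG, WeierstrassCurve.sigmaSqG, ← hS, mul_assoc, mul_comm (invOfUnit _ _),
        mul_invOfUnit _ _ (by rw [hU0, Units.val_one]), mul_one]
    have hPS : (W.formalOmega * G) * S = 2 * S + X * d⁄dX A S := by rw [← hGmul]; ring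
    -- `g₀ = 2`
    have hg0 : coeff 0 G = 2 := by
      have h := congrArg constantCoeff hGmul
      rw [map_mul, hU0, mul_one, map_add, map_mul, map_mul, constantCoeff_X, zero_mul, add_zero,
        h2C, constantCoeff_C, hS0, mul_one] at h
      rw [coeff_zero_eq_constantCoeff_apply, h]
    -- `g₁ = s₁ − 2a₁`
    have hg1 : coeff 1 G = coeff 3 Sq - 2 * W.a₁ := by
      have hX1 : coeff 1 (X * d⁄dX A S) = coeff 1 S := by
        rw [show (1 : ℕ) = 0 + 1 from rfl, coeff_succ_X_mul, coeff_derivative]; simp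
      have lhs : coeff 1 (G * (W.formalOmega * S)) = 2 * (coeff 3 Sq + W.a₁) + coeff 1 G := by
        rw [coeff_one_mul_eq, coeff_one_mul_eq, hω0, hω1, hg0, one_mul, coeff_zero_eq_constantCoeff_apply, hS0,
          coeff_zero_eq_constantCoeff_apply, hU0, hS1]; ring
      have rhs : coeff 1 (2 * S + X * d⁄dX A S) = 2 * coeff 3 Sq + coeff 3 Sq := by
        rw [map_add, h2C, coeff_C_mul, hX1, hS1]
      have h := congrArg (coeff 1) hGmul
      rw [lhs, rhs] at h
      linear_combination h
    -- the recursion from the ODE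
    have hrec : ∀ n : ℕ, (n : A) * coeff (n + 1) G =
        -2 * coeff (n + 1) (W.formalOmega * (W.formalXMulSq + C c * X ^ 2)) := by
      intro n
      have h := hODE
      rw [WeierstrassCurve.SatisfiesSigmaSqODE] at h
      have h' := congrArg (coeff (n + 1)) h
      rw [h2C, coeff_C_mul, map_sub, coeff_succ_X_mul, coeff_derivative] at h'
      rw [hG]
      linear_combination h'
    exact ⟨hPS, hg0, hg1, hrec⟩
  obtain ⟨hPS₁, hg0₁, hg1₁, hrec₁⟩ := key Sq₁ h0₁ h1₁ h2₁ hODE₁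
  obtain ⟨hPS₂, hg0₂, hg1₂, hrec₂⟩ := key Sq₂ h0₂ h1₂ h2₂ hODE₂
  -- (1) the two `G`'s coincide
  have hGeq : W.sigmaSqG Sq₁ = W.sigmaSqG Sq₂ := by
    ext n
    rcases n with _ | n
    · rw [hg0₁, hg0₂]
    · rcases n with _ | n
      · rw [zero_add, hg1₁, hg1₂, h3]
      · have e := (hrec₁ (n + 1)).trans (hrec₂ (n + 1)).symm
        have hu : IsUnit ((n + 1 : ℕ) : A) := by
          rw [← map_natCast (algebraMap ℚ A)]
          exact (isUnit_iff_ne_zero.mpr (Nat.cast_ne_zero.mpr (Nat.succ_ne_zero n))).map _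
        exact hu.mul_left_cancel e
  -- (2) the two `S`'s coincide, by the linear recursion
  set P : A⟦X⟧ := W.formalOmega * W.sigmaSqG Sq₁ with hP
  have hP0 : coeff 0 P = 2 := by
    rw [hP, coeff_zero_eq_constantCoeff, map_mul, W.constantCoeff_formalOmega, one_mul,
      ← coeff_zero_eq_constantCoeff_apply, hg0₁]
  have hPS₂' : P * sigmaShift (sigmaShift Sq₂) =
      2 * sigmaShift (sigmaShift Sq₂) + X * d⁄dX A (sigmaShift (sigmaShift Sq₂)) := by
    rw [hP, hGeq]; exact hPS₂
  have hcoef : ∀ S : A⟦X⟧, P * S = 2 * S + X * d⁄dX A S → ∀ n : ℕ,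
      ((n : A) + 1) * coeff (n + 1) S = ∑ i ∈ Finset.range (n + 1), coeff (i + 1) P * coeff (n - i) S := by
    intro S hS n
    have h := congrArg (coeff (n + 1)) hS
    rw [coeff_mul, Finset.Nat.sum_antidiagonal_eq_sum_range_succ_mk, Finset.sum_range_succ', hP0,
      Nat.sub_zero, map_add, h2C, coeff_C_mul, coeff_succ_X_mul, coeff_derivative] at h
    have hsum : ∑ i ∈ Finset.range (n + 1), coeff (i + 1) P * coeff (n + 1 - (i + 1)) S =
        ∑ i ∈ Finset.range (n + 1), coeff (i + 1) P * coeff (n - i) S := by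
      refine Finset.sum_congr rfl fun i _ => ?_
      rw [Nat.add_sub_add_right]
    rw [hsum] at h
    linear_combination -h
  have hc₁ := hcoef _ hPS₁
  have hc₂ := hcoef _ hPS₂'
  have hSeq : ∀ n : ℕ, ∀ j ≤ n, coeff j (sigmaShift (sigmaShift Sq₁)) = coeff j (sigmaShift (sigmaShift Sq₂)) := by
    intro n
    induction n with
    | zero =>
      intro j hj
      obtain rfl : j = 0 := Nat.le_zero.mp hj
      rw [coeff_zero_eq_constantCoeff_apply, coeff_zero_eq_constantCoeff_apply, constantCoeff_sigmaShift,
        coeff_sigmaShift, h2₁, constantCoeff_sigmaShift, coeff_sigmaShift, h2₂]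
    | succ n ih =>
      intro j hj
      rcases Nat.lt_or_ge j (n + 1) with hlt | hge
      · exact ih j (by omega)
      · obtain rfl : j = n + 1 := le_antisymm hj hge
        have e₁ := hc₁ n
        have e₂ := hc₂ n
        have hs : ∑ i ∈ Finset.range (n + 1), coeff (i + 1) P * coeff (n - i) (sigmaShift (sigmaShift Sq₁)) =
            ∑ i ∈ Finset.range (n + 1), coeff (i + 1) P * coeff (n - i) (sigmaShift (sigmaShift Sq₂)) :=
          Finset.sum_congr rfl fun i _ => by rw [ih (n - i) (Nat.sub_le n i)]
        have hu : IsUnit ((n : A) + 1) := by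
          rw [← Nat.cast_succ, ← map_natCast (algebraMap ℚ A)]
          exact (isUnit_iff_ne_zero.mpr (Nat.cast_ne_zero.mpr (Nat.succ_ne_zero n))).map _
        exact hu.mul_left_cancel (e₁.trans (hs.trans e₂.symm))
  have hS : sigmaShift (sigmaShift Sq₁) = sigmaShift (sigmaShift Sq₂) := by
    ext n; exact hSeq n n le_rfl
  -- (3) `Σ = t²·S`
  calc Sq₁ = X * (X * sigmaShift (sigmaShift Sq₁)) := by
        rw [X_mul_sigmaShift (by rw [constantCoeff_sigmaShift, h1₁]), X_mul_sigmaShift h0₁]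
    _ = X * (X * sigmaShift (sigmaShift Sq₂)) := by rw [hS]
    _ = Sq₂ := by rw [X_mul_sigmaShift (by rw [constantCoeff_sigmaShift, h1₂]), X_mul_sigmaShift h0₂]

/-! ### §2 50E — the unique even constant-`0` sigma-squared series -/

/-- **50E — EXISTENCE AND UNIQUENESS OF `Σ₀`** (kernel; every prime `p`, every Weierstrass model over `ℚ_p`): exactly one
`Σ₀ = t² + O(t⁴) ∈ ℚ_p⟦t⟧` is formally even and satisfies the sigma-squared equation with constant `0`.  Existence: the square of
the odd constant-`0` formal sigma function; uniqueness: evenness forces `[t³]Σ₀ = a₁`, then `eq_of_satisfiesSigmaSqODE`.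
[cite: MazurSteinTate2006, Thm. 1.3, §3.1] [cite: BlakestadGrant2023, Thm. 1] -/
theorem existsUnique_isFormallyEven_satisfiesSigmaSqODE_zero {p : ℕ} [Fact p.Prime] (V : WeierstrassCurve ℚ_[p]) :
    ∃! Sq : ℚ_[p]⟦X⟧, constantCoeff Sq = 0 ∧ coeff 1 Sq = 0 ∧ coeff 2 Sq = 1 ∧ V.IsFormallyEven Sq ∧
      V.SatisfiesSigmaSqODE Sq 0 := by
  obtain ⟨σ, h10, h11, hodd, hODE⟩ := V.exists_isFormallyOdd_satisfiesSigmaODE_zero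
  have hT0 : constantCoeff (σ ^ 2) = 0 := by rw [map_pow, h10, zero_pow two_ne_zero]
  have hT1 : coeff 1 (σ ^ 2) = 0 := by
    rw [pow_two, coeff_one_mul_eq, coeff_zero_eq_constantCoeff_apply, h10]; ring
  have hT2 : coeff 2 (σ ^ 2) = 1 := by
    rw [pow_two, coeff_two_mul_eq, coeff_zero_eq_constantCoeff_apply, h10, h11]; ring
  refine ⟨σ ^ 2, ⟨hT0, hT1, hT2, hodd.sq, hODE.sq h10 h11⟩, fun Sq hSq => ?_⟩
  obtain ⟨h0, h1, h2, heven, hODE'⟩ := hSq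
  have h3 : coeff 3 Sq = coeff 3 (σ ^ 2) := by
    have e1 := two_mul_coeff_three_of_isFormallyEven heven h0 h1 h2
    have e2 := two_mul_coeff_three_of_isFormallyEven hodd.sq hT0 hT1 hT2
    exact mul_left_cancel₀ two_ne_zero (e1.trans e2.symm)
  exact eq_of_satisfiesSigmaSqODE V h0 h1 h2 hT0 hT1 hT2 h3 hODE' (hODE.sq h10 h11)

end NaiveSigmaLogAtTwo

end Summit.BirchSwinnertonDyer.BirchSwinnertonDyer.Theorems
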